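import Literature.MathematicalPhysics.QuantumFieldTheory.Balaban1983to89.B9PinMembersKLevelV1
import Literature.MathematicalPhysics.QuantumFieldTheory.Balaban1983to89.B9Thm314QGGQInvFlatTransfer

/-!
# `Balaban1983to89.B9PinGeometryKLevelV1` — Stage-3′(Y) GEOMETRY∕INDEX layer, MODULE 4: the NON-OPERATOR carrier fields of `DagBinding.PrintedCarriers9X` at a
# member — the additional distance `d(y, y′, Ω)` of (3.154), the localisation «y ∈ Ω^{(k)}» of Theorem 3.14, the Sect.-E predicates «y ∈ Λ» and `|y − y′|` of
# Theorem 3.15, the constants `d`, the O(1) of (3.35), and Cor. 3.6's membership «Ω′₀ ⊂ □» (EMPTY on the torus of record — located)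

B9 = T. Bałaban, *Propagators for lattice gauge theories in a background field*, Commun. Math. Phys. **99** (1985) 389–434 [Balaban1985BackgroundPropagators].
pub-ymgap Track A, node N06; seat `pub-ymgap-dag-n06-a` g3 = «def-Y» (director-ym LINE №32, rails (i)–(vi)).  DEFINITIONS (readings of landed geometry) +
sign∕structure lemmas; nothing of [B9]'s estimates asserted; count-neutral.  Every field reads p21's flat-precedent geometry `B9Thm314GpFlatTorusGeometry`
(`dOmega`, `tdistK`, `OmegaC`) BY NAME at the two sequences `x.D`, `x.D′` of a member `x : B9PinMembersKLevelV1.MemberY …`; sites of the member's geometry are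
the index bonds `b : BondIdx (domT x.hN x.D x.hk)` (`Node00.kGeoU`, «sites replaced by bonds»), read at their base point `B6Ineq2142KLevelV1.baseSite … b`
and its `k`-block label `kLab x b`.

WHAT IS DEFINED ∕ PROVED.
* §1 `kLab x b` (the `k`-block label of the base point); **`dOmegaY x b b′ := dOmega x.D x.D′ (kLab x b) (kLab x b′)`** = (3.154) (p21), `dOmegaY_nonneg`, and the
  sub-additivity along `T^{(k)}` — `dOmegaY_le_unitDist_add`, `dOmegaY_le_add_unitDist` (p21's `dOmega_le_tdistK_add`∕`_add_tdistK`: the hypotheses `hFl`∕`hFr`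
  of `B9Thm314ExtraFactor` and `hF`-type facts of the t314 resolvent toolkit); **`unitDistY x b b′ := tdistK (kLab x b) (kLab x b′)`** (`|y − y′|` on `T₁^{(k)}`,
  p21), `unitDistY_nonneg`, `unitDistY_triangle`, `unitDistY_comm`.
* §2 **`OmKY x b`** («y ∈ Ω^{(k)}», Thm 3.14 p. 426: a top-level localisation point in BOTH `Ω_k` and `Ω′_k`), **`inΛY x b`** («y ∈ Λ», Thm 3.15), `inΛY_top`,
  `inΛY_diag` (the diagonal members have `Λ = ∅`: no site is in `Λ` there).
* §3 constants: `d9Y := d + 1`, **`c35Y := 10`** (p. 396 «O(1) will mean a number ≤ 10»; MODULE 2's located reading (c)), `c35Y_pos`.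
* §5 **`dictAtOneY`** — the knit's 25-field `U = 1` dictionary `B9FromB6.DictAtOne (Node00.kGeoU i) (geo9Y x) B (GpU i) (CinvU i) (GU i) Gp GA C` at a member
  for ANY operator readings `Gp, GA, C`, REDUCED to the eight operator comparisons at `U = 1` (geometry half `id`∕`rfl`, dag-n03-b's §4; design §7 `dict_geo9`).
* §4 **`InCubeY x`** = Cor. 3.6's «Ω′₀ ⊂ □ for a cube □ of the class described in (3.35)» read on the torus of record (`Ω₀ = Ω₁ = T_η` in p21's families) and its
  LOCATED REFUTATION **`not_inCubeY`**: a class cube is a genuine cube (side `<` period), so the whole torus never fits — AT THIS PIN `B9.Cor36Printed` IS VACUOUS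
  and the Sect.-C local operators `G′_□, C_□, G_□` (p. 409) have no member; an operator layer for Sect. C needs a second member sort on a Dirichlet carrier
  ([4] p. 228∕248 «G(Ω) with Dirichlet boundary conditions on Ωᶜ»), not typed in the tree.  The knit is formally unaffected (`c36` is DERIVED in
  `B9.sectsAC_architecture`; Thm 3.7's use of Cor. 3.6 is inside the leaf `Thm37Printed`).
HONEST SCOPE: readings and bookkeeping; no operator; one finite lattice programme; NOT continuum ∕ OS ∕ mass gap ∕ Clay.
-/

noncomputable section

namespace Literature.MathematicalPhysics.QuantumFieldTheory.Balaban1983to89.B9PinGeometryKLevelV1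

open B4Reflection242 (blk)
open B6MultiLevelBoxOperator (bigSide N0)
open B6SectAOperatorsV1 (BondIdx)
open B6KLevelCensusIndexV1 (KIdx)
open B6GlobalChartV1 (PV toBox domT)
open B6Ineq2142KLevelV1 (lvl baseSite)
open B9Thm314GpFlatTorusGeometry (dOmega tdistK dOmega_nonneg tdistK_nonneg)
open B9Thm314QGGQInvFlatTransfer (tdistK_triangle tdistK_comm dOmega_le_tdistK_add dOmega_le_add_tdistK)
open B9BackgroundsKLevelV1 (cubeClass396 IsCube396 torusCube)
open B9PinMembersKLevelV1 (MemberY geo9Y)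

variable {d ℓ : ℕ} {hd : 1 ≤ d + 1} {hL : Odd (ℓ + 1) ∧ 1 < ℓ + 1} {b₀ b₁ : ℝ} {Mstar : ℕ}

/-! ## §1 (3.154) and `|y − y′|` on `T^{(k)}` at a member -/

/-- the `k`-block LABEL of (the base point of) a site of the member's geometry: the point of `T^{(k)}` the localisation `y` determines.
[cite: Balaban1985BackgroundPropagators, (3.154) p.427 («y₁ ∈ Ωᶜ ∩ T^{(k)}»; dictionary)] -/
def kLab (x : MemberY d ℓ hd hL b₀ b₁ Mstar) (b : BondIdx (domT x.hN x.D x.hk)) : Fin (d + 1) → ℤ :=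
  blk ((ℓ + 1) ^ x.k) (toBox x.hN (baseSite x.hN x.D x.hk b)).1

/-- **(3.154) AT A MEMBER**: `d(y, y′, Ω) = inf_{y₁ ∈ Ωᶜ ∩ T^{(k)}} (|y − y₁| + |y₁ − y′|)`, `Ω = Ω_k ∩ Ω′_k` — p21's `dOmega` for the member's two sequences at the
`k`-block labels of the two localisation points. [cite: Balaban1985BackgroundPropagators, Thm 3.14 (3.154) pp.426–427] -/
def dOmegaY (x : MemberY d ℓ hd hL b₀ b₁ Mstar) (b b' : BondIdx (domT x.hN x.D x.hk)) : ℝ :=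
  dOmega x.D x.D' (kLab x b) (kLab x b')

/-- **`|y − y′|` ON THE UNIT LATTICE `T₁^{(k)}` AT A MEMBER** (Thm 3.15 (3.187)): p21's `tdistK` at the two `k`-block labels.
[cite: Balaban1985BackgroundPropagators, Thm 3.15 (3.187) p.432 («|y − y′|, y, y′ ∈ Λ»)] -/
def unitDistY (x : MemberY d ℓ hd hL b₀ b₁ Mstar) (b b' : BondIdx (domT x.hN x.D x.hk)) : ℝ :=
  tdistK (ℓ := ℓ) (Mh := x.Mh) (k := x.k) (P := x.P') (kLab x b) (kLab x b')

/-- `d(y, y′, Ω) ≥ 0`. [cite: Balaban1985BackgroundPropagators, (3.154) p.427] -/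
theorem dOmegaY_nonneg (x : MemberY d ℓ hd hL b₀ b₁ Mstar) (b b' : BondIdx (domT x.hN x.D x.hk)) : 0 ≤ dOmegaY x b b' :=
  dOmega_nonneg _ _ _ _

/-- `|y − y′| ≥ 0`. [cite: Balaban1985BackgroundPropagators, (3.187) p.432 (dictionary)] -/
theorem unitDistY_nonneg (x : MemberY d ℓ hd hL b₀ b₁ Mstar) (b b' : BondIdx (domT x.hN x.D x.hk)) : 0 ≤ unitDistY x b b' :=
  tdistK_nonneg _ _

/-- `|y − y″| ≤ |y − y′| + |y′ − y″|`. [cite: Balaban1985BackgroundPropagators, (3.187) p.432 (dictionary)] -/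
theorem unitDistY_triangle (x : MemberY d ℓ hd hL b₀ b₁ Mstar) (b b' b'' : BondIdx (domT x.hN x.D x.hk)) :
    unitDistY x b b'' ≤ unitDistY x b b' + unitDistY x b' b'' :=
  tdistK_triangle _ _ _

/-- `|y − y′| = |y′ − y|`. [cite: Balaban1985BackgroundPropagators, (3.187) p.432 (dictionary)] -/
theorem unitDistY_comm (x : MemberY d ℓ hd hL b₀ b₁ Mstar) (b b' : BondIdx (domT x.hN x.D x.hk)) : unitDistY x b b' = unitDistY x b' b :=
  tdistK_comm _ _

/-- **`d(y, y″, Ω) ≤ |y − y′| + d(y′, y″, Ω)`** (the sub-additivity `hFl` of the t314 toolkit `B9Thm314ExtraFactor`).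
[cite: Balaban1985BackgroundPropagators, (3.154) p.427] -/
theorem dOmegaY_le_unitDist_add (x : MemberY d ℓ hd hL b₀ b₁ Mstar) (b b' b'' : BondIdx (domT x.hN x.D x.hk)) :
    dOmegaY x b b'' ≤ unitDistY x b b' + dOmegaY x b' b'' :=
  dOmega_le_tdistK_add _ _ _ _ _

/-- **`d(y, y″, Ω) ≤ d(y, y′, Ω) + |y′ − y″|`** (the sub-additivity `hFr`). [cite: Balaban1985BackgroundPropagators, (3.154) p.427] -/
theorem dOmegaY_le_add_unitDist (x : MemberY d ℓ hd hL b₀ b₁ Mstar) (b b' b'' : BondIdx (domT x.hN x.D x.hk)) :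
    dOmegaY x b b'' ≤ dOmegaY x b b' + unitDistY x b' b'' :=
  dOmega_le_add_tdistK _ _ _ _ _

/-! ## §2 «y ∈ Ω^{(k)}» (Thm 3.14) and «y ∈ Λ» (Thm 3.15) -/

/-- **«y ∈ Ω^{(k)}»** (p. 426: «localizations determined by points y, y′ ∈ Ω^{(k)}», `Ω = Ω_k ∩ Ω′_k`): the localisation point of `b` is a top-level point lying in
`Ω_k` (its own level is `k`) and in `Ω′_k` (level `k` for the second sequence). [cite: Balaban1985BackgroundPropagators, Thm 3.14 pp.426–427] -/
def OmKY (x : MemberY d ℓ hd hL b₀ b₁ Mstar) (b : BondIdx (domT x.hN x.D x.hk)) : Prop :=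
  lvl x.hN x.D x.hk b = x.k ∧ x.D'.lev (toBox x.hN (baseSite x.hN x.D x.hk b)).1 = x.k

/-- **«y ∈ Λ»** (Thm 3.15: `Λ ⊂ Λ_k` a union of big blocks, `y, y′ ∈ Λ` points of `T₁^{(k)}`): a top-level site whose base point lies in the member's `Λ`.
[cite: Balaban1985BackgroundPropagators, Thm 3.15 (3.187) p.432] -/
def inΛY (x : MemberY d ℓ hd hL b₀ b₁ Mstar) (b : BondIdx (domT x.hN x.D x.hk)) : Prop :=
  lvl x.hN x.D x.hk b = x.k ∧ baseSite x.hN x.D x.hk b ∈ x.Λ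

/-- a site in `Λ` is a top-level site. [cite: Balaban1985BackgroundPropagators, Thm 3.15 p.432 («Λ ⊂ Λ_k»)] -/
theorem inΛY_top {x : MemberY d ℓ hd hL b₀ b₁ Mstar} {b : BondIdx (domT x.hN x.D x.hk)} (h : inΛY x b) : lvl x.hN x.D x.hk b = x.k :=
  h.1

/-- at a DIAGONAL member (`Λ = ∅`) no site is in `Λ` (Thm 3.15 vacuous THERE). [cite: Balaban1985BackgroundPropagators, Thm 3.15 p.432 (bookkeeping)] -/
theorem not_inΛY_diag (i : KIdx d ℓ hd hL b₀ b₁) (hcf : i.cf = (((ℓ + 1 : ℕ) : ℝ)) ^ i.k) (hM : Mstar ≤ (ℓ + 1) * i.Mh)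
    (b : BondIdx (domT i.hN i.D i.hk)) : ¬ inΛY (MemberY.diag i hcf hM : MemberY d ℓ hd hL b₀ b₁ Mstar) b :=
  fun h => h.2

/-! ## §3 The numeric carriers `d` and the O(1) of (3.35) -/

/-- the dimension carrier of the [B9] leaf at these members: `d + 1` (the V1 torus `PV d ℓ …` has `d + 1` directions).
[cite: Balaban1985BackgroundPropagators, Thm 3.2 (3.48) p.398 («(L^{j′}η)^{−d}»)] -/
def d9Y (d : ℕ) : ℕ := d + 1

/-- **the O(1) of (3.35)**: `10` (p. 396 «Here O(1) will mean a number ≤ 10»; with MODULE 2's located reading (c) the class at `c = 10` contains print's).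
[cite: Balaban1985BackgroundPropagators, p.396 («O(1) will mean a number ≤ 10»)] -/
def c35Y : ℝ := 10

/-- `0 < c35Y` (the knit's `hc`). [cite: Balaban1985BackgroundPropagators, p.396 (bookkeeping)] -/
theorem c35Y_pos : 0 < c35Y := by norm_num [c35Y]

/-- `c35Y = 10`. [cite: Balaban1985BackgroundPropagators, p.396 (bookkeeping)] -/
theorem c35Y_eq : c35Y = 10 := rfl

/-! ## §4 Cor. 3.6's membership «Ω′₀ ⊂ □» — empty on the torus of record (located) -/

/-- **Cor. 3.6's membership** (p. 408: «If a configuration U satisfies (3.35) … and Ω′₀ ⊂ □ for a cube □ of the class described in this condition»): the member's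
domain `Ω₀` — on p21's torus families ALL of `T_η` (`Ω₀ = Ω₁ = T_η`) — lies inside a class cube.  It is REFUTED at every member (`not_inCubeY`, from `IsCube396`'s
own wrap clause «side < period»): a LOCATED FRAME LIMITATION of p21's torus families (the Sect.-C local operators `G′_□ ∕ C_□ ∕ G_□` of p. 409 have no member at this
pin), NOT a gap of this module and not a second gap — in the knit `c36` is DERIVED inside `B9.sectsAC_architecture` (from `c35` + the gauge reduction) and Thm 3.7's
use of Cor. 3.6 sits INSIDE the leaf `B9.Thm37Printed` (r1's typing).  The SECOND member sort this calls for («(□, {Ω_n(□)})» on a Dirichlet carrier: [4] p. 228 ∕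
p. 248 «G(Ω) with Dirichlet boundary conditions on Ωᶜ», `B9FromB6.DictAtOne` docstring, GAPS G-A1-2) belongs to the unassigned operator layer.
VACUITY-CLASS NOTE: no bond with `OmKY` or `inΛY` TRUE is exhibited in this module (the witnesses live at the `L = 5` member of
`B9PinMembersKLevelV1.memberY_exists_nonempty_Λ` and need the V1 base-site plumbing); owed with the chart extension, as ref-A's note on MODULE 3.
[cite: Balaban1985BackgroundPropagators, Cor. 3.6 p.408] -/
def InCubeY (x : MemberY d ℓ hd hL b₀ b₁ Mstar) : Prop :=
  ∃ q ∈ cubeClass396 x.toKIdx, Set.univ ⊆ q.1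

/-- a torus cube of side `s <` period misses a point: the site `c + s·e_μ` (its `μ`-th coordinate offset is exactly `s`).
[cite: Balaban1985BackgroundPropagators, p.396 (the class cubes are proper cubes; bookkeeping)] -/
theorem exists_not_mem_torusCube {P : Params} (c : Site P 0) {s : ℕ} (hs : s < P.sitesPerDir 0) : ∃ x, x ∉ torusCube c s := by
  classical
  let μ : Fin P.d := ⟨0, P.hd⟩
  refine ⟨Function.update c μ (c μ + s), fun hx => ?_⟩
  have h := hx μ
  simp only [Function.update_self, add_sub_cancel_left, ZMod.val_natCast, Nat.mod_eq_of_lt hs] at h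
  exact lt_irrefl _ h

/-- **Cor. 3.6 HAS NO MEMBER ON THE TORUS OF RECORD** (located): `InCubeY x` is false for every member — the whole torus `Ω₀ = T_η` does not fit in a class
cube (side `n·M·Lʲ <` period). [cite: Balaban1985BackgroundPropagators, Cor. 3.6 p.408 (bookkeeping: vacuity of the typed membership at these carriers)] -/
theorem not_inCubeY (x : MemberY d ℓ hd hL b₀ b₁ Mstar) : ¬ InCubeY x := by
  rintro ⟨q, hq, hsub⟩
  obtain ⟨c, n, -, -, -, hper, hq1⟩ := hq.2.2.1
  obtain ⟨y, hy⟩ := exists_not_mem_torusCube c hper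
  exact hy (hq1 ▸ hsub (Set.mem_univ y))

/-- hence `B9.Cor36Printed` at these carriers holds VACUOUSLY for any operator fields and constants (recorded so no one reads content into it).
[cite: Balaban1985BackgroundPropagators, Cor. 3.6 p.408 (bookkeeping: the typed statement is vacuous when no member satisfies «Ω′₀ ⊂ □»)] -/
theorem cor36Printed_vacuous (dd : ℕ) (c : ℝ) (bg : MemberY d ℓ hd hL b₀ b₁ Mstar → B9.Backgrounds)
    (Gp GA : ∀ x : MemberY d ℓ hd hL b₀ b₁ Mstar, B9.KernelFamily (geo9Y x) (bg x))
    (Cinv : ∀ x : MemberY d ℓ hd hL b₀ b₁ Mstar, B9.SiteKernel (geo9Y x) (bg x)) :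
    B9.Cor36Printed dd c geo9Y bg InCubeY Gp GA Cinv :=
  ⟨1, 1, 1, 1, fun _ => 1, fun _ => 1, fun _ _ => 1, 1, 1, one_pos, one_pos, one_pos, one_pos, one_pos, one_pos,
    fun x hx => absurd hx (not_inCubeY x)⟩

/-! ## §5 The `U = 1` dictionary at a member MODULO THE OPERATOR LAYER -/

/-- **THE `U = 1` DICTIONARY OF THE KNIT AT A MEMBER, MODULO THE OPERATOR LAYER**: for ANY background carrier `B` and ANY operator readings `Gp`, `GA`, `C` over the
member's geometry, the 25-field dictionary `B9FromB6.DictAtOne (Node00.kGeoU i) (geo9Y x) B (Node00.GpU i) (Node00.CinvU i) (Node00.GU i) Gp GA C` (what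
`B9LeafKnit.b9_main_at_run_of_leaves` consumes) REDUCES to the eight operator comparisons at `U = 1` — the geometry half is `id`∕`rfl` (dag-n03-b's §4 of
`B9GeoNormsKLevelV1`, (W) reading of `suppInT`); the eight inequalities are the operator layer's identification «G′(1) = Δ′_a⁻¹ of [4]» (G-A1-2), DISPLAYED.
[cite: Balaban1985BackgroundPropagators, Cor. 3.5 proof p.407 («for U = 1 these theorems are proved in [4]»; the dictionary at the pin)] -/
def dictAtOneY (x : MemberY d ℓ hd hL b₀ b₁ Mstar) {B : B9.Backgrounds} (Gp GA : B9.KernelFamily (geo9Y x) B) (C : B9.SiteKernel (geo9Y x) B)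
    (hGp_e : ∀ (n : Fin 4) (lam : (geo9Y x).Loc) (y : (geo9Y x).Site), Gp.e n B.one lam y ≤ (Node00.GpU x.toKIdx).e n lam y)
    (hGp_h1 : ∀ (lam : (geo9Y x).Loc) (b : ℝ) (ζ : (geo9Y x).Cut), Gp.h1 B.one lam b ζ ≤ (Node00.GpU x.toKIdx).h1 lam b ζ)
    (hC : ∀ y y' : (geo9Y x).Site, |C.ker B.one y y'| ≤ |(Node00.CinvU x.toKIdx).ker y y'|)
    (hGA_e : ∀ (n : Fin 4) (lam : (geo9Y x).Loc) (y : (geo9Y x).Site), GA.e n B.one lam y ≤ (Node00.GU x.toKIdx).e n lam y)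
    (hGA_h1 : ∀ (lam : (geo9Y x).Loc) (b : ℝ) (ζ : (geo9Y x).Cut), GA.h1 B.one lam b ζ ≤ (Node00.GU x.toKIdx).h1 lam b ζ)
    (hGA_e4 : ∀ (lam : (geo9Y x).Loc) (y : (geo9Y x).Site), GA.e4 B.one lam y ≤ (Node00.GU x.toKIdx).e4 lam y)
    (hGA_h2 : ∀ (lam : (geo9Y x).Loc) (b : ℝ) (ζ : (geo9Y x).Cut), GA.h2 B.one lam b ζ ≤ (Node00.GU x.toKIdx).h2 lam b ζ)
    (hGA_l2 : ∀ (n : Fin 6) (lam : (geo9Y x).Loc) (h : (geo9Y x).Cut), GA.l2 n B.one lam h ≤ (Node00.GU x.toKIdx).l2 n lam h) :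
    B9FromB6.DictAtOne (Node00.kGeoU x.toKIdx) (geo9Y x) B (Node00.GpU x.toKIdx) (Node00.CinvU x.toKIdx) (Node00.GU x.toKIdx) Gp GA C where
  site := id
  loc := id
  cut := id
  hyp := trivial
  M_eq := rfl
  len_eq _ := rfl
  dist_eq _ _ := rfl
  supp _ _ h := h
  suppT _ _ h := h
  cutIn _ _ h := h
  cutT _ _ h := h
  supNorm_eq _ := rfl
  l2Norm_eq _ := rfl
  holder_eq _ _ := rfl
  cutH_eq _ _ := rfl
  cutSup_eq _ := rfl
  Gp_e := hGp_e
  Gp_h1 := hGp_h1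
  C_ker := hC
  GA_e := hGA_e
  GA_h1 := hGA_h1
  GA_e4 := hGA_e4
  GA_h2 := hGA_h2
  GA_l2 := hGA_l2

end Literature.MathematicalPhysics.QuantumFieldTheory.Balaban1983to89.B9PinGeometryKLevelV1

end
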